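import Summits.CriticalPhenomena.PercolationContinuityZ3.Theorems.Transplant.SkelPhiParaRouteN
import Summits.CriticalPhenomena.PercolationContinuityZ3.Theorems.Transplant.SkelPhiRootBridgeGeom
import Summits.CriticalPhenomena.PercolationContinuityZ3.Theorems.Transplant.KNParaRootBridge
import HarnessLib

/-!
# N1 (the `{±1}` node), (R) column (N1-R-PLAN v2 §4 (R5b); NEG-SCOPE B.13): THE ROUTE DATUM OF THE BRIDGE STEP —
# **`Skelφ.routeSets_bridge`**: at a kit centre `c` of a level of the bridge step (root-frame image in the `R′`-enlarged landing box, `c ∈ B(w₀, R − r)`),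
# an abstract bridge event `linkIn ↑Qb (Λ c kz) Fb` valid for `P_q` — region `Qb ⊆ B(c, R_b)` read in the root frame inside `c ± pr`, piece `Fb ⊆ Qb` read
# inside `c + [dlo, dhi]`, off the zone — yields the route sets `(Qt, Ft) = (Qb, Fb)`: `Ft ⊆ T ⊇ Win(core 1)`, `Qt ⊆ Dr ⊇ Win(region)`, `Ft` off the zone,
# and the certificate transferred to the subbox weighting (p1-g11's `routeSetsN_x` for the frame `BridgePrm.bridgeFrame`);
# plus the THREE CONCRETE BRIDGE STRIDES of B.13 read for it: `bridgeSets_same` (x side half of `φ`), `bridgeSets_tr_side` (x side half of `trφ φ`,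
# `σ' = sign h_b`), `bridgeSets_tr_top` (y′ top piece of `trφ φ`) — each: region in the ball and in `c ± pgScale`, piece in the region and in its
# displacement box (`SkelPhiRootBridgeGeom`), piece off the zone cylinder

builds on p205010 (kernel theorem, internal audit signed; external expert review pending) — nothing in this file uses p205010; nothing here is a claim about the open node.
Lane `prim-bschramm`, seat `prim-bschramm-p3` (gen 9; design owner + (R) owner); helper file (`--supports stmt-CriticalPhenomena-4575 --as helper`).
[cite: KozmaNitzan2024, §4 Lemma 10 Step IV (pp. 20–21), Lemma 11 (pp. 22–23), p. 28] [cite: MartineauTassion2017, §3.2, §4.3 Lemma 4.2]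
-/

noncomputable section

open scoped Classical

namespace Summit.CriticalPhenomena.PercolationContinuityZ3.Theorems.Transplant

namespace Skelφ

open MeasureTheory ProbabilityTheory
open Literature.Probability.Percolation Literature.Probability.LatticeModels SimpleGraph KNLevels
open Literature.Barriers.CriticalPhenomena (graphBall graphBall_mono)
open Skel (winGraph winGraph_le)
open ChainPlanar

variable {V : Type} {G : SimpleGraph V} {φ : V → Site 2}

/-! ## §1 The abstract route datum of the bridge step -/

/-- **THE ROUTE SETS OF THE BRIDGE STRIDE.** Kit centre `c` with root-frame image in the `R′`-enlarged landing box and `c ∈ B(w₀, R − r)`, `R_b ≤ r ≤ R`;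
bridge region `Qb ⊆ B(c, R_b)` read inside `rootFrame c ± pr`, bridge piece `Fb ⊆ Qb` read inside `rootFrame c + [dlo, dhi]`, `Fb` off the zone `Z`;
then `Ft := Fb ⊆ T`, `Qt := Qb ⊆ Dr`, and `P_{Wt}(linkIn Qb SEED Fb) = P_q(…) > 1 − δ₂`. [cite: KozmaNitzan2024, §4 Lemma 10 Step IV (pp. 20–21)] -/
theorem routeSets_bridge [DecidableEq V] [Countable V] [G.LocallyFinite] (t : V) (σ : ℤ) (B : BridgePrm) {w₀ c : V} {R r Rb : ℕ}
    (hc : rootFrame φ t σ c ∈ Finset.Icc (B.B₀lo - ((B.R' : ℕ) : Site 2)) (B.B₀hi + ((B.R' : ℕ) : Site 2)))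
    (hcw : c ∈ graphBall G w₀ (R - r)) (hr : Rb ≤ r) (hrR : r ≤ R) {Z Qb Fb : Finset V}
    (hQb : ∀ w ∈ Qb, w ∈ graphBall G c Rb ∧
      rootFrame φ t σ w ∈ Finset.Icc (rootFrame φ t σ c - ((B.pr : ℕ) : Site 2)) (rootFrame φ t σ c + ((B.pr : ℕ) : Site 2)))
    (hFb : ∀ w ∈ Fb, w ∈ Qb ∧ rootFrame φ t σ w ∈ Finset.Icc (rootFrame φ t σ c + B.dlo) (rootFrame φ t σ c + B.dhi))
    (hFZ : Disjoint Fb Z) {Dr T : Finset V}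
    (hPD : Win G (rootFrame φ t σ) w₀ (Finset.Icc B.regionLo B.regionHi) R ⊆ Dr)
    (hPT : Win G (rootFrame φ t σ) w₀ (Finset.Icc B.core1Lo B.core1Hi) R ⊆ T)
    {q : unitInterval} {Wt : Sym2 V → unitInterval} (hWD : IsSubbox (winGraph G w₀ R) Wt q Dr) {SEED : Finset V} {δ₂ : ℝ}
    (hev : 1 - δ₂ < (bondPercolation G q).real (linkIn (↑Qb : Set V) SEED Fb)) :
    ∃ Qt Ft : Finset V, Ft ⊆ T ∧ Qt ⊆ Dr ∧ Disjoint Ft Z ∧ 1 - δ₂ < (prodBernoulli Wt).real (linkIn (↑Qt : Set V) SEED Ft) := by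
  have hQB : ∀ w ∈ Qb, w ∈ graphBall G w₀ R := fun w hw => by
    have h1 : w ∈ graphBall G c r := graphBall_mono G c hr (hQb w hw).1
    have h2 := BoxProdZ2.mem_graphBall_add G hcw h1
    rwa [Nat.sub_add_cancel hrR] at h2
  have hQD : Qb ⊆ Dr := fun w hw =>
    hPD ((mem_Win G _).2 ⟨hQB w hw, BridgePrm.box_subset_region_of_mem_enl hc (hQb w hw).2⟩)
  refine ⟨Qb, Fb, fun w hw => ?_, hQD, hFZ, ?_⟩
  · exact hPT ((mem_Win G _).2 ⟨hQB w (hFb w hw).1, BridgePrm.disp_subset_core1_of_mem_enl hc (hFb w hw).2⟩)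
  · rw [Skel.real_eq_of_isSubbox_of_le (winGraph_le G w₀ R) hWD hQD (Skel.adj_winGraph_of_subset_graphBall hQB)
      (determinedBy_linkIn (↑Qb : Set V) SEED Fb subset_rfl) (measurableSet_linkIn _ _ _)]
    exact hev

/-! ## §2 The three concrete bridge strides (NEG-SCOPE B.13) -/

/-- Symmetric boxes grow with the radius. [folklore] -/
theorem Icc_pm_natCast_mono (x : Site 2) {a b : ℕ} (hab : a ≤ b) :
    Finset.Icc (x - ((a : ℕ) : Site 2)) (x + ((a : ℕ) : Site 2)) ⊆ Finset.Icc (x - ((b : ℕ) : Site 2)) (x + ((b : ℕ) : Site 2)) := by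
  refine Finset.Icc_subset_Icc (fun i => ?_) (fun i => ?_) <;> simp only [Pi.sub_apply, Pi.add_apply, Pi.natCast_apply] <;> omega

/-- Translated boxes grow with the corners. [folklore] -/
theorem Icc_add_mono (x : Site 2) {a b a' b' : Site 2} (ha : a' ≤ a) (hb : b ≤ b') : Finset.Icc (x + a) (x + b) ⊆ Finset.Icc (x + a') (x + b') := by
  refine Finset.Icc_subset_Icc (fun i => ?_) (fun i => ?_) <;> simp only [Pi.add_apply]
  · linarith [ha i]
  · linarith [hb i]

/-- **Case `o_b = o_L`**: region `pgramPrismFin G φ c n h (3ℓ) R_b`, piece the x side half `pgSideHalfW G φ c n h ℓ R_b σ τ`; readings for `routeSets_bridge`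
when `pgScale n h (3ℓ) ≤ pr`, `dlo ≤ (n, σh + min 0 (τℓ))`, `(n, σh + max 0 (τℓ)) ≤ dhi`, and the zone `Z ⊆ cyl φ c Mz` with `Mz < n`.
[cite: MartineauTassion2017, §3.2] -/
theorem bridgeSets_same [G.LocallyFinite] (t : V) {σ : ℤ} (hσ : σ = 1 ∨ σ = -1) (B : BridgePrm) {c : V} {n : ℕ} (hn : 1 ≤ n) {h : ℤ} {ℓ Rb : ℕ}
    {τ : ℤ} (hτ : τ = 1 ∨ τ = -1) (hpr : pgScale n h (3 * ℓ) ≤ B.pr) (hdlo : B.dlo ≤ pt n (σ * h + min 0 (τ * ℓ)))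
    (hdhi : pt n (σ * h + max 0 (τ * ℓ)) ≤ B.dhi) {Z : Finset V} {Mz : ℕ} (hZ : (↑Z : Set V) ⊆ cyl φ c Mz) (hMz : Mz < n) :
    (∀ w ∈ pgramPrismFin G φ c n h (3 * ℓ) Rb, w ∈ graphBall G c Rb ∧
      rootFrame φ t σ w ∈ Finset.Icc (rootFrame φ t σ c - ((B.pr : ℕ) : Site 2)) (rootFrame φ t σ c + ((B.pr : ℕ) : Site 2))) ∧
    (∀ w ∈ pgSideHalfW G φ c n h ℓ Rb σ τ, w ∈ pgramPrismFin G φ c n h (3 * ℓ) Rb ∧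
      rootFrame φ t σ w ∈ Finset.Icc (rootFrame φ t σ c + B.dlo) (rootFrame φ t σ c + B.dhi)) ∧
    Disjoint (pgSideHalfW G φ c n h ℓ Rb σ τ) Z := by
  refine ⟨fun w hw => ?_, fun w hw => ?_, ?_⟩
  · have hw' := (mem_pgramPrismFin G φ).1 hw
    exact ⟨pgramPrism_subset_graphBall c n h (3 * ℓ) Rb hw',
      Icc_pm_natCast_mono _ hpr (rootFrame_mem_box_of_prism t hσ hw')⟩
  · exact ⟨(mem_pgramPrismFin G φ).2 (coe_pgSideHalfW_subset (G := G) (φ := φ) c n h ℓ Rb σ τ (Finset.mem_coe.2 hw)),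
      Icc_add_mono _ hdlo hdhi (rootFrame_mem_box_of_sideHalf_same t hσ hn hτ hw)⟩
  · have hd := disjoint_pgSideHalfW_cyl (G := G) (φ := φ) c hMz h ℓ Rb hσ τ
    exact Finset.disjoint_left.2 fun w hw hz => Set.disjoint_left.1 hd (Finset.mem_coe.2 hw) (hZ (Finset.mem_coe.2 hz))

/-- **Case `o_b ≠ o_L`, steep (`2|h_b| > ℓ_b − 11`)**: region `pgramPrismFin G (trφ φ) c n h (3ℓ) R_b`, piece the x side half of the transposed map
`pgSideHalfW G (trφ φ) c n h ℓ R_b (σs) σ` with `s·h = |h|`; readings when `pgScale ≤ pr`, `dlo ≤ (|h|, σ s n)`, `(|h| + ℓ, σ s n) ≤ dhi`, zone `Z ⊆ cyl φ c Mz`, `Mz < n`.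
[cite: MartineauTassion2017, §3.2] -/
theorem bridgeSets_tr_side [G.LocallyFinite] (t : V) {σ : ℤ} (hσ : σ = 1 ∨ σ = -1) (B : BridgePrm) {c : V} {n : ℕ} (hn : 1 ≤ n) {h : ℤ} {ℓ Rb : ℕ}
    {s : ℤ} (hs1 : s = 1 ∨ s = -1) (hs : s * h = |h|) (hpr : pgScale n h (3 * ℓ) ≤ B.pr) (hdlo : B.dlo ≤ pt |h| (σ * s * n))
    (hdhi : pt (|h| + ℓ) (σ * s * n) ≤ B.dhi) {Z : Finset V} {Mz : ℕ} (hZ : (↑Z : Set V) ⊆ cyl φ c Mz) (hMz : Mz < n) :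
    (∀ w ∈ pgramPrismFin G (trφ φ) c n h (3 * ℓ) Rb, w ∈ graphBall G c Rb ∧
      rootFrame φ t σ w ∈ Finset.Icc (rootFrame φ t σ c - ((B.pr : ℕ) : Site 2)) (rootFrame φ t σ c + ((B.pr : ℕ) : Site 2))) ∧
    (∀ w ∈ pgSideHalfW G (trφ φ) c n h ℓ Rb (σ * s) σ, w ∈ pgramPrismFin G (trφ φ) c n h (3 * ℓ) Rb ∧
      rootFrame φ t σ w ∈ Finset.Icc (rootFrame φ t σ c + B.dlo) (rootFrame φ t σ c + B.dhi)) ∧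
    Disjoint (pgSideHalfW G (trφ φ) c n h ℓ Rb (σ * s) σ) Z := by
  refine ⟨fun w hw => ?_, fun w hw => ?_, ?_⟩
  · have hw' := (mem_pgramPrismFin G (trφ φ)).1 hw
    exact ⟨pgramPrism_subset_graphBall c n h (3 * ℓ) Rb hw',
      Icc_pm_natCast_mono _ hpr (rootFrame_mem_box_of_prism_tr t hσ hw')⟩
  · exact ⟨(mem_pgramPrismFin G (trφ φ)).2 (coe_pgSideHalfW_subset (G := G) (φ := trφ φ) c n h ℓ Rb (σ * s) σ (Finset.mem_coe.2 hw)),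
      Icc_add_mono _ hdlo hdhi (rootFrame_mem_box_of_sideHalf_tr t hσ hn hs hw)⟩
  · have hσs : σ * s = 1 ∨ σ * s = -1 := by rcases hσ with rfl | rfl <;> rcases hs1 with rfl | rfl <;> simp
    have hd := disjoint_pgSideHalfW_cyl (G := G) (φ := trφ φ) c hMz h ℓ Rb hσs σ
    rw [cyl_trφ] at hd
    exact Finset.disjoint_left.2 fun w hw hz => Set.disjoint_left.1 hd (Finset.mem_coe.2 hw) (hZ (Finset.mem_coe.2 hz))

/-- **Case `o_b ≠ o_L`, flat (`2|h_b| ≤ ℓ_b − 11`)**: region `pgramPrismFin G (trφ φ) c n h (3ℓ) R_b`, piece the top piece of the transposed map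
`pgTopPieceW G (trφ φ) c n h ℓ R_b σ τ v` (`|h| ≤ 10 n`); readings when `pgScale ≤ pr`, `dlo ≤ (ℓ − |h| − 11, −n)`, `(ℓ + |h|, n) ≤ dhi`, zone `Z ⊆ cyl φ c Mz`
with the clearance `(Mz + 4)(n + |h|) ≤ n(ℓ + 1)`. [cite: MartineauTassion2017, §3.2] -/
theorem bridgeSets_tr_top [G.LocallyFinite] (t : V) {σ : ℤ} (hσ : σ = 1 ∨ σ = -1) (B : BridgePrm) {c : V} {n : ℕ} (hn : 1 ≤ n) {h : ℤ}
    (hκ : h.natAbs ≤ 10 * n) {ℓ Rb : ℕ} {τ v : ℤ} (hpr : pgScale n h (3 * ℓ) ≤ B.pr) (hdlo : B.dlo ≤ pt ((ℓ : ℤ) - |h| - 11) (-(n : ℤ)))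
    (hdhi : pt ((ℓ : ℤ) + |h|) n ≤ B.dhi) {Z : Finset V} {Mz : ℕ} (hZ : (↑Z : Set V) ⊆ cyl φ c Mz) (hclr : (Mz + 4) * (n + h.natAbs) ≤ n * (ℓ + 1)) :
    (∀ w ∈ pgramPrismFin G (trφ φ) c n h (3 * ℓ) Rb, w ∈ graphBall G c Rb ∧
      rootFrame φ t σ w ∈ Finset.Icc (rootFrame φ t σ c - ((B.pr : ℕ) : Site 2)) (rootFrame φ t σ c + ((B.pr : ℕ) : Site 2))) ∧
    (∀ w ∈ pgTopPieceW G (trφ φ) c n h ℓ Rb σ τ v, w ∈ pgramPrismFin G (trφ φ) c n h (3 * ℓ) Rb ∧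
      rootFrame φ t σ w ∈ Finset.Icc (rootFrame φ t σ c + B.dlo) (rootFrame φ t σ c + B.dhi)) ∧
    Disjoint (pgTopPieceW G (trφ φ) c n h ℓ Rb σ τ v) Z := by
  refine ⟨fun w hw => ?_, fun w hw => ?_, ?_⟩
  · have hw' := (mem_pgramPrismFin G (trφ φ)).1 hw
    exact ⟨pgramPrism_subset_graphBall c n h (3 * ℓ) Rb hw',
      Icc_pm_natCast_mono _ hpr (rootFrame_mem_box_of_prism_tr t hσ hw')⟩
  · exact ⟨(mem_pgramPrismFin G (trφ φ)).2 (coe_pgTopPieceW_subset (G := G) (φ := trφ φ) c n h ℓ Rb σ τ v (Finset.mem_coe.2 hw)),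
      Icc_add_mono _ hdlo hdhi (rootFrame_mem_box_of_topPiece_tr t hσ hn hκ hw)⟩
  · have hd := disjoint_pgTopPieceW_cyl (G := G) (φ := trφ φ) c hn hclr Rb hσ τ v
    rw [cyl_trφ] at hd
    exact Finset.disjoint_left.2 fun w hw hz => Set.disjoint_left.1 hd (Finset.mem_coe.2 hw) (hZ (Finset.mem_coe.2 hz))

end Skelφ

end Summit.CriticalPhenomena.PercolationContinuityZ3.Theorems.Transplant

end
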